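import Literature.MathematicalPhysics.QuantumLattice.HubbardOpenBoxEDCertificateKroneckerBlocks
import Literature.MathematicalPhysics.QuantumLattice.HubbardNNNHoppingClusterLowerBound2x3
import Summits.Ventures.CertifiedManyBodySolver.Certificates.HubbardSquare_kacf2x3_U8_tpm1o5_S0
import HarnessLib

/-!
# Kernel-checked Anderson `2 × 3` cluster floors of the `t–t'` Hubbard energy density at `(t, t', U) = (1, -1/5, 8)` — data-free certificates, part 4 (sector checks) of 6

HONEST FRAMING: certified energy-window bookkeeping (hypothesis-free LOWER rows); not a superconductivity
verdict; no number of record at an anchor moves.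

The open cluster `h_{2×3}(t₁, t₁', U₁)` with `(t₁, t₁', U₁) = (7680/53760, -2688/53760, 35840/53760)` (so that
`(7t₁, 4t₁', 12U₁) = (1, -1/5, 8)`): for every spin sector `(p, q)` the KERNEL ITSELF computes a fixed-point
Cholesky factor of the shifted integer sector block and checks it as a packed rounded Gram certificate
(`OccupationCode.KCert.check`, `HubbardOpenBoxEDCertificateKronecker`: Kronecker-substitution dot products, diagonally
dominant residual); only the sector code lists and the shifts are data (part 1 holds them); the 28 sector checks with
`p ≤ q` (the others are their spin-exchange images, `groundEnergy_ge_of_kCerts₂`) are spread over 4 files by kernel cost,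
and the last part assembles the table `σ k ≤ E₀(h_{2×3}, k)` (`k = 0..12`) and Anderson's cluster cover
(`ClusterLowerBound.energyDensityTT'_ge_of_boxFloors_2x3`)
into HYPOTHESIS-FREE affine density rows `2m − 12μ·n ≤ e(1, -1/5, 8, n)`.
Floors (cluster units): σ0 = -0.0000187, σ1 = -0.2741816, σ2 = -0.4960752, σ3 = -0.5965402, σ4 = -0.6355655, σ5 = -0.5799294, σ6 = -0.4676712, σ7 = -0.0028088, σ8 = 0.4929129, σ9 = 1.1570498, σ10 = 1.9117931, σ11 = 2.9177269, σ12 = 3.9999813.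
Generator: HOME/hubbard-box-p2/code/kldl/kldl_gen.py + kldl_emit.py (bit-exact twin of the kernel's factoriser; floats
only locate the shift). [cite: Anderson1951, eq. (2)] [cite: LinGubernatis1993, §II] [cite: Harvey2009, §3.1]
-/

namespace Summit.Ventures.CertifiedManyBodySolver.Certificates

open Literature.MathematicalPhysics.QuantumLattice OccupationCode ClusterLowerBound ThermodynamicLimit

/-- Kernel check of the sector `(4, 5)` (as `(4, 9 − 4)`; `n = 90`): the kernel factorises and verifies.
[cite: Rump2006PosDef, §2] -/
theorem kacf2x3_U8_tpm1o5_chk_4_5 : (kacf2x3_U8_tpm1o5_certAt 4 (9 - 4)).check 2 3 4 (9 - 4) 7680 (-2688) 35840 53760 (kacf2x3_U8_tpm1o5_codes 4 (9 - 4)) = true := by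
  decide +kernel

end Summit.Ventures.CertifiedManyBodySolver.Certificates
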